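import Summits.HodgeConjecture.HodgeConjecture.Theorems.Ring2WeilCoverageRealUnitNormReduction
import Summits.HodgeConjecture.HodgeConjecture.Theorems.Ring2WeilCoverageCMTypeSetOddPositions
import Summits.HodgeConjecture.HodgeConjecture.Theorems.Ring2WeilCoverageCMTypeSetChineseRemainder
import Mathlib.Algebra.CharP.Lemmas
import HarnessLib

/-!
# Weil-type family coverage — THEOREM L (i) BY FROBENIUS, WITHOUT ORBIT HYPOTHESES: if `n = n₀·q^b` (`q` prime, `b ≥ 1`,
# `q ∤ n₀`, `n₀ ≥ 3`) and `ℤ[ζₙ]` maps to a ring of characteristic `q` with `2 ≠ 0` killing the `q`-power roots of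
# unity, then NO unit of `ℚ(ζₙ)⁺` has norm `−1`

research route conditional on HC_CM; not a corollary; Q11.4-sentence-2 already refuted in dim ≥ 3.

Ring 2, WEIL-TYPE FAMILY-COVERAGE CENSUS (`HOME/WEIL-FAMILY-COVERAGE.md` `## b01`, block b01.44 «THEOREM L (i) at every
level»; owner ring2-b01), part 66 of the `Ring2WeilCoverage*` series.  THEOREM L (i) — «every unit of `ℚ(ζ_M)⁺` has
norm `+1`» — is the obstruction input of the census's polarisation-type criteria (parts 2, 7, 48, 53, 55, 60b); it was
proved level by level (parts 8/9/10: a quadratic subfield `ℚ(√q)`, `q ≡ 3 (4)`; part 31: cyclic quartic units at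
`35, 45`; part 57: `12 ∣ M`; parts 62/63: reduction modulo a ramified prime with a ONE-ORBIT hypothesis
`⟨q, −1⟩ = (ℤ/n₀)ˣ` and an exponent count, at `40, 52`) and refuted at `32` (part 61).  This file proves it ONCE, for
every level `n = n₀·q^b` as in the title, by a new orbit-free form of the reduction argument:

Let `u ∈ 𝓞 K⁺` be a unit of norm `−1`, `U ∈ ℤ[ζ]` its (real) image, `ψ : ℤ[ζ] → R` a ring map with `char R = q`,
`2 ≠ 0` and `ψ(ζ)^{n₀} = 1`.  Take a CM type set `T₀` mod `n₀` (`n₀ ≥ 3`) and the CM type set `T = T₀ × (ℤ/q^b)ˣ`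
mod `n` (Chinese remainder, part 65); part 62 gives `∏_{t ∈ T} σ_t(U) = −1`.  Since `ψ ∘ σ_t` only depends on
`t mod n₀` (ring maps out of `ℤ[ζ]` agreeing on `ζ`), `ψ(−1) = z^{φ(q^b)}` with `z = ∏_{s ∈ T₀} F(s)`,
`F(s) = ψ(σ_{(s,1)} U)`.  Frobenius: `F(s)^q = F(qs)` (again by comparing ring maps on `ζ`), and `F(−s) = F(s)` because
`U` is real (`σ_{−t} = σ_t ∘ ρ`); as `qT₀` is another CM type set and the product of an even function does not depend
on the CM type set, `z^q = z`.  So `w = z^{q−1}` is idempotent and `−1 = z^{q^{b−1}(q−1)} = w`, whence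
`1 = w² = w = −1`, `2 = 0` in `R`: contradiction.  (Exactly the three hypotheses are used: `b ≥ 1` makes `q − 1` divide
`φ(q^b)`; `n₀ ≥ 3` makes `T₀` exist; `2 ≠ 0` is the punch line.)

* §1 ring maps out of `ℤ[ζ]` (`ringHom_ext_toInteger`), the action of `σ_t` and `ρ` on `ζ` (`mapRingHom_toInteger`,
  `conj_toInteger`), and the three transport rules `map_aut_eq_of_pow_eq` (`ψ ∘ σ = ψ ∘ σ′`), `pow_map_aut_eq`
  (`Frob ∘ ψ ∘ σ = ψ ∘ σ′`), `map_aut_eq_of_conj` (`ψ ∘ σ′ = ψ ∘ σ` on real elements);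
* §2 **`norm_realUnits_pos_of_ringHom`** — the engine as displayed.

Part 67 supplies `ψ` (reduction modulo a maximal ideal over `q`, any odd prime `q`) and states THEOREM L (i) at every
level `n ∉ {2^a, p^a, 2p^a}`.

HONEST FRAMING: elementary algebraic number theory (`𝓞 ℚ(ζₙ) = ℤ[ζₙ]`, Galois automorphisms, Frobenius in characteristic
`q`, idempotents); nothing here is a statement about Hodge classes, `W_K`, general members or HC; `HC_CM` is used
nowhere.  No `def`, no named fact, no `sorry`.

References: [cite: Washington1997, §2, Prop. 2.16 and Thm. 2.5]; [cite: Garbanati1976UnitsNormMinusOne] (units of norm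
`−1` and unit signatures in real abelian fields — background for the statement; the reduction proof is seat-derived);
census b01.28 THEOREM L (i), b01.43 (C), b01.44.
-/

noncomputable section

open scoped Classical nonZeroDivisors NumberField
open NumberField Module Polynomial Finset

namespace Summit.HodgeConjecture.Ring2WeilCoverage.RealUnitNormFrobenius

open Literature.AlgebraicGeometry.HodgeTheory (IsCMTypeSet)
open Summit.HodgeConjecture.Ring2WeilCoverage.CMTypeSetOddPositions (isCMTypeSet_lower)
open Summit.HodgeConjecture.Ring2WeilCoverage.CMTypeSetChineseRemainder
open Summit.HodgeConjecture.Ring2WeilCoverage.RealUnitNormReduction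
  (exists_aut_apply_eq_pow prod_aut_eq_neg_one_of_norm_eq_neg_one coe_algebraMap_realIntegers)

/-! ### §1 Ring maps out of `ℤ[ζ]`, the automorphisms `σ_t` and complex conjugation -/

section Reduction

variable {K : Type} [Field K] [NumberField K] {n : ℕ} [NeZero n] {ζ : K}

/-- Two ring maps out of `𝓞 ℚ(ζₙ) = ℤ[ζ]` that agree on `ζ` are equal (integral power basis).
research route conditional on HC_CM; not a corollary; Q11.4-sentence-2 already refuted in dim ≥ 3. [cite: Washington1997, §2, Prop. 2.16] -/
theorem ringHom_ext_toInteger [IsCyclotomicExtension {n} ℚ K] (hζ : IsPrimitiveRoot ζ n) {R : Type*}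
    [CommRing R] {f g : 𝓞 K →+* R} (h : f hζ.toInteger = g hζ.toInteger) : f = g := by
  have H : f.toIntAlgHom = g.toIntAlgHom := by
    apply hζ.integralPowerBasis.algHom_ext
    rw [hζ.integralPowerBasis_gen]
    exact h
  exact RingHom.ext fun x => DFunLike.congr_fun H x

/-- The automorphism `σ : ζ ↦ ζ^k` acts on the integer `ζ` by `ζ ↦ ζ^k`.
research route conditional on HC_CM; not a corollary; Q11.4-sentence-2 already refuted in dim ≥ 3. [folklore] -/
theorem mapRingHom_toInteger (hζ : IsPrimitiveRoot ζ n) {σ : K ≃ₐ[ℚ] K} {k : ℕ} (hσ : σ ζ = ζ ^ k) :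
    RingOfIntegers.mapRingHom σ.toRingEquiv.toRingHom hζ.toInteger = hζ.toInteger ^ k :=
  RingOfIntegers.ext (by rw [RingOfIntegers.mapRingHom_apply]; push_cast; exact hσ)

/-- Complex conjugation acts on the integer `ζ` by `ζ ↦ ζ^(n−1)`.
research route conditional on HC_CM; not a corollary; Q11.4-sentence-2 already refuted in dim ≥ 3. [folklore] -/
theorem conj_toInteger [IsCMField K] (hζ : IsPrimitiveRoot ζ n) :
    RingOfIntegers.mapRingHom (IsCMField.complexConj K).toRingEquiv.toRingHom hζ.toInteger =
      hζ.toInteger ^ (n - 1) := by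
  have hζinv : IsCMField.complexConj K ζ = ζ ^ (n - 1) := by
    obtain ⟨φ⟩ := (inferInstance : Nonempty (K →+* ℂ))
    apply φ.injective
    rw [IsCMField.complexEmbedding_complexConj, map_pow]
    have hn1 : ‖φ ζ‖ = 1 := Complex.norm_eq_one_of_pow_eq_one (by rw [← map_pow, hζ.pow_eq_one, map_one])
      (NeZero.ne n)
    rw [← Complex.inv_eq_conj hn1]
    apply inv_eq_of_mul_eq_one_right
    rw [← pow_succ', Nat.sub_add_cancel (Nat.one_le_iff_ne_zero.mpr (NeZero.ne n)), ← map_pow, hζ.pow_eq_one,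
      map_one]
  exact RingOfIntegers.ext (by rw [RingOfIntegers.mapRingHom_apply]; push_cast; exact hζinv)

/-- **`ψ ∘ σ = ψ ∘ σ'` when `ψ(ζ)^k = ψ(ζ)^{k'}`** (`σ ζ = ζ^k`, `σ' ζ = ζ^{k'}`): ring maps agreeing on `ζ`.
research route conditional on HC_CM; not a corollary; Q11.4-sentence-2 already refuted in dim ≥ 3. [folklore] -/
theorem map_aut_eq_of_pow_eq [IsCyclotomicExtension {n} ℚ K] (hζ : IsPrimitiveRoot ζ n) {R : Type*} [CommRing R]
    (ψ : 𝓞 K →+* R) {σ σ' : K ≃ₐ[ℚ] K} {k k' : ℕ} (hσ : σ ζ = ζ ^ k) (hσ' : σ' ζ = ζ ^ k')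
    (h : ψ hζ.toInteger ^ k = ψ hζ.toInteger ^ k') (x : 𝓞 K) :
    ψ (RingOfIntegers.mapRingHom σ.toRingEquiv.toRingHom x) =
      ψ (RingOfIntegers.mapRingHom σ'.toRingEquiv.toRingHom x) := by
  have H := ringHom_ext_toInteger hζ (f := ψ.comp (RingOfIntegers.mapRingHom σ.toRingEquiv.toRingHom))
    (g := ψ.comp (RingOfIntegers.mapRingHom σ'.toRingEquiv.toRingHom))
    (by rw [RingHom.comp_apply, RingHom.comp_apply, mapRingHom_toInteger hζ hσ, mapRingHom_toInteger hζ hσ',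
      map_pow, map_pow, h])
  exact DFunLike.congr_fun H x

/-- **`Frob ∘ ψ ∘ σ = ψ ∘ σ'` when `ψ(ζ)^{kq} = ψ(ζ)^{k'}`** in characteristic `q` (`σ ζ = ζ^k`, `σ' ζ = ζ^{k'}`).
research route conditional on HC_CM; not a corollary; Q11.4-sentence-2 already refuted in dim ≥ 3. [folklore] -/
theorem pow_map_aut_eq [IsCyclotomicExtension {n} ℚ K] (hζ : IsPrimitiveRoot ζ n) {R : Type*} [CommRing R]
    {q : ℕ} [Fact q.Prime] [CharP R q] (ψ : 𝓞 K →+* R) {σ σ' : K ≃ₐ[ℚ] K} {k k' : ℕ} (hσ : σ ζ = ζ ^ k)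
    (hσ' : σ' ζ = ζ ^ k') (h : ψ hζ.toInteger ^ (q * k) = ψ hζ.toInteger ^ k') (x : 𝓞 K) :
    ψ (RingOfIntegers.mapRingHom σ.toRingEquiv.toRingHom x) ^ q =
      ψ (RingOfIntegers.mapRingHom σ'.toRingEquiv.toRingHom x) := by
  have H := ringHom_ext_toInteger hζ
    (f := (frobenius R q).comp (ψ.comp (RingOfIntegers.mapRingHom σ.toRingEquiv.toRingHom)))
    (g := ψ.comp (RingOfIntegers.mapRingHom σ'.toRingEquiv.toRingHom))
    (by
      rw [RingHom.comp_apply, RingHom.comp_apply, RingHom.comp_apply, mapRingHom_toInteger hζ hσ,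
        mapRingHom_toInteger hζ hσ', map_pow ψ, map_pow ψ, map_pow (frobenius R q), frobenius_def, ← pow_mul,
        h])
  have := DFunLike.congr_fun H x
  rwa [RingHom.comp_apply, RingHom.comp_apply, RingHom.comp_apply, frobenius_def] at this

/-- **`ψ ∘ σ' = ψ ∘ σ` on REAL elements when `ψ(ζ)^{k'} = ψ(ζ)^{k(n−1)}`** (`σ ζ = ζ^k`, `σ' ζ = ζ^{k'}`): then
`ψ ∘ σ' = ψ ∘ σ ∘ ρ` with `ρ` complex conjugation (`ρ ζ = ζ^{n−1}`), and `ρ x = x`.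
research route conditional on HC_CM; not a corollary; Q11.4-sentence-2 already refuted in dim ≥ 3. [folklore] -/
theorem map_aut_eq_of_conj [IsCMField K] [IsCyclotomicExtension {n} ℚ K] (hζ : IsPrimitiveRoot ζ n) {R : Type*}
    [CommRing R] (ψ : 𝓞 K →+* R) {σ σ' : K ≃ₐ[ℚ] K} {k k' : ℕ} (hσ : σ ζ = ζ ^ k) (hσ' : σ' ζ = ζ ^ k')
    (h : ψ hζ.toInteger ^ k' = ψ hζ.toInteger ^ (k * (n - 1))) {x : 𝓞 K}
    (hx : RingOfIntegers.mapRingHom (IsCMField.complexConj K).toRingEquiv.toRingHom x = x) :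
    ψ (RingOfIntegers.mapRingHom σ'.toRingEquiv.toRingHom x) =
      ψ (RingOfIntegers.mapRingHom σ.toRingEquiv.toRingHom x) := by
  have H := ringHom_ext_toInteger hζ (f := ψ.comp (RingOfIntegers.mapRingHom σ'.toRingEquiv.toRingHom))
    (g := ψ.comp ((RingOfIntegers.mapRingHom σ.toRingEquiv.toRingHom).comp
      (RingOfIntegers.mapRingHom (IsCMField.complexConj K).toRingEquiv.toRingHom)))
    (by
      rw [RingHom.comp_apply, RingHom.comp_apply, RingHom.comp_apply, mapRingHom_toInteger hζ hσ',
        conj_toInteger hζ, map_pow (RingOfIntegers.mapRingHom σ.toRingEquiv.toRingHom),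
        mapRingHom_toInteger hζ hσ, ← pow_mul, map_pow ψ, map_pow ψ, h])
  have := DFunLike.congr_fun H x
  rwa [RingHom.comp_apply, RingHom.comp_apply, RingHom.comp_apply, hx] at this

end Reduction

/-! ### §2 THE ENGINE: a ring map to characteristic `q` killing the `q`-power roots of unity -/

section Engine

variable {K : Type} [Field K] [NumberField K] [IsCMField K] {n : ℕ} [NeZero n] {ζ : K}

/-- **THEOREM L (i), GENERAL ENGINE.**  Let `K = ℚ(ζₙ)` with `n = n₀·q^b`, `q` prime, `b ≥ 1`, `(n₀, q) = 1`,
`n₀ ≥ 3`, and let `ψ : 𝓞 K → R` be a ring map to a commutative ring of characteristic `q` with `2 ≠ 0` in which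
`ψ(ζ)^{n₀} = 1`.  Then every unit of `𝓞 K⁺` has norm `+1`.
PROOF.  A unit `u` of norm `−1` gives `∏_{t ∈ T} σ_t(U) = −1` in `ℤ[ζ]` for every CM type set `T` (part 62); take
`T = T₀ × (ℤ/q^b)ˣ` (Chinese remainder) for a CM type set `T₀` mod `n₀`.  Since `ψ ∘ σ_t` only depends on
`t mod n₀`, `ψ(−1) = z^{φ(q^b)}` with `z = ∏_{s ∈ T₀} ψ(σ_{(s,1)} U)`.  Frobenius permutes the factors of `z` up to
the signs `s ↦ ±qs`, which do not matter because `U` is real: `z^q = z`.  Hence `w = z^{q−1}` is idempotent,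
`−1 = z^{q^{b−1}(q−1)} = w`, so `1 = w² = w = −1` and `2 = 0` in `R` — contradiction.
research route conditional on HC_CM; not a corollary; Q11.4-sentence-2 already refuted in dim ≥ 3. [cite: Washington1997, §2, Prop. 2.16] -/
theorem norm_realUnits_pos_of_ringHom [IsCyclotomicExtension {n} ℚ K] (hζ : IsPrimitiveRoot ζ n)
    {n₀ q b : ℕ} [hq : Fact q.Prime] (hn : n = n₀ * q ^ b) (hb : b ≠ 0) (hcop : n₀.Coprime q) (hn₀ : 2 < n₀)
    {R : Type*} [CommRing R] [CharP R q] (h2 : (2 : R) ≠ 0) (ψ : 𝓞 K →+* R)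
    (hr : ψ hζ.toInteger ^ n₀ = 1) (v : (𝓞 (maximalRealSubfield K))ˣ) :
    0 < Algebra.norm ℚ (((v : 𝓞 (maximalRealSubfield K)) : maximalRealSubfield K)) := by
  -- the norm of a unit is `±1`
  have hvZ : IsUnit (Algebra.norm ℤ (v : 𝓞 (maximalRealSubfield K))) := v.isUnit.map _
  have hnormQ : Algebra.norm ℚ (((v : 𝓞 (maximalRealSubfield K)) : maximalRealSubfield K)) =
      ((Algebra.norm ℤ (v : 𝓞 (maximalRealSubfield K)) : ℤ) : ℚ) :=
    (Algebra.coe_norm_int _).symm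
  rcases Int.isUnit_iff.mp hvZ with h1 | hneg1
  · rw [hnormQ, h1]; norm_num
  exfalso
  have hu : Algebra.norm ℚ (((v : 𝓞 (maximalRealSubfield K)) : maximalRealSubfield K)) = -1 := by
    rw [hnormQ, hneg1]; norm_num
  -- automorphisms `σ_t : ζ ↦ ζ^t`
  have hσ : ∀ t : ZMod n, ∃ σ : K ≃ₐ[ℚ] K, t.val.Coprime n → σ ζ = ζ ^ t.val := fun t => by
    by_cases ht : t.val.Coprime n
    · obtain ⟨σ, hσ⟩ := exists_aut_apply_eq_pow hζ t ht
      exact ⟨σ, fun _ => hσ⟩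
    · exact ⟨AlgEquiv.refl, fun h => absurd h ht⟩
  choose σf hσf using hσ
  -- the real unit `U`
  set U : 𝓞 K := algebraMap (𝓞 (maximalRealSubfield K)) (𝓞 K) (v : 𝓞 (maximalRealSubfield K)) with hUdef
  have hcU : RingOfIntegers.mapRingHom (IsCMField.complexConj K).toRingEquiv.toRingHom U = U := by
    refine RingOfIntegers.ext ?_
    rw [RingOfIntegers.mapRingHom_apply, hUdef, coe_algebraMap_realIntegers]
    exact IsCMField.complexConj_apply_eq_self K _
  -- a CM type set mod `n₀` and its Chinese-remainder product set mod `n`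
  haveI : NeZero n₀ := ⟨by omega⟩
  obtain ⟨T₀, hT₀⟩ : ∃ T₀ : Finset (ZMod n₀), IsCMTypeSet n₀ T₀ := ⟨_, isCMTypeSet_lower hn₀⟩
  have hcop' : n₀.Coprime (q ^ b) := Nat.Coprime.pow_right b hcop
  subst hn
  set e := ZMod.chineseRemainder hcop' with he
  set Uq : Finset (ZMod (q ^ b)) := Finset.univ.image fun a : (ZMod (q ^ b))ˣ => (a : ZMod (q ^ b)) with hUq
  have hT := isCMTypeSet_chineseRemainder hcop' hT₀
  rw [← he] at hT
  have hP := prod_aut_eq_neg_one_of_norm_eq_neg_one hζ hT hσf hu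
  rw [← hUdef] at hP
  -- `G t = ψ (σ_t U)` and the three transport rules
  set r : R := ψ hζ.toInteger with hrdef
  set G : ZMod (n₀ * q ^ b) → R := fun t => ψ (RingOfIntegers.mapRingHom (σf t).toRingEquiv.toRingHom U)
    with hGdef
  have hmod : ∀ k k' : ℕ, (k : ZMod n₀) = (k' : ZMod n₀) → r ^ k = r ^ k' := by
    intro k k' hkk'
    rw [pow_eq_pow_mod k hr, pow_eq_pow_mod k' hr, (ZMod.natCast_eq_natCast_iff' k k' n₀).mp hkk']
  have hunit : ∀ t : ZMod (n₀ * q ^ b), IsUnit t → t.val.Coprime (n₀ * q ^ b) :=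
    fun t ht => (coprime_iff_isUnit t).mpr ht
  have hG : ∀ t t' : ZMod (n₀ * q ^ b), IsUnit t → IsUnit t' → (t.val : ZMod n₀) = (t'.val : ZMod n₀) →
      G t = G t' := fun t t' ht ht' htt' =>
    map_aut_eq_of_pow_eq hζ ψ (hσf t (hunit t ht)) (hσf t' (hunit t' ht')) (hmod _ _ htt') U
  have hGq : ∀ t t' : ZMod (n₀ * q ^ b), IsUnit t → IsUnit t' →
      (t'.val : ZMod n₀) = (q : ZMod n₀) * (t.val : ZMod n₀) → G t ^ q = G t' := by
    intro t t' ht ht' htt'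
    refine pow_map_aut_eq hζ ψ (hσf t (hunit t ht)) (hσf t' (hunit t' ht')) (hmod _ _ ?_) U
    push_cast
    rw [htt']
  have hGneg : ∀ t t' : ZMod (n₀ * q ^ b), IsUnit t → IsUnit t' →
      (t'.val : ZMod n₀) = -(t.val : ZMod n₀) → G t' = G t := by
    intro t t' ht ht' htt'
    refine map_aut_eq_of_conj hζ ψ (hσf t (hunit t ht)) (hσf t' (hunit t' ht')) (hmod _ _ ?_) hcU
    have h1 : 1 ≤ n₀ * q ^ b := Nat.one_le_iff_ne_zero.mpr (NeZero.ne _)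
    push_cast [Nat.cast_sub h1]
    rw [ZMod.natCast_self, zero_mul, zero_sub, mul_neg_one, htt']
  -- `F s = G (s, 1)` is even and Frobenius acts on it by `s ↦ q s`
  set F : ZMod n₀ → R := fun s => G (e.symm (s, 1)) with hFdef
  have hℓu : ∀ s : ZMod n₀, IsUnit s → IsUnit (e.symm (s, 1)) := fun s hs =>
    isUnit_chineseRemainder_symm hcop' hs isUnit_one
  have hℓ : ∀ s : ZMod n₀, ((e.symm (s, 1)).val : ZMod n₀) = s := fun s =>
    val_chineseRemainder_symm_cast hcop' (s, 1)
  have hqu : IsUnit (q : ZMod n₀) := (ZMod.isUnit_iff_coprime q n₀).mpr hcop.symm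
  have hFeven : ∀ s : ZMod n₀, s.val.Coprime n₀ → F (-s) = F s := by
    intro s hs
    have hsu := (coprime_iff_isUnit s).mp hs
    exact hGneg _ _ (hℓu s hsu) (hℓu (-s) hsu.neg) (by rw [hℓ, hℓ])
  have hFq : ∀ s ∈ T₀, F s ^ q = F ((q : ZMod n₀) * s) := by
    intro s hs
    have hsu := (coprime_iff_isUnit s).mp (hT₀.1 s hs)
    exact hGq _ _ (hℓu s hsu) (hℓu _ (hqu.mul hsu)) (by rw [hℓ, hℓ])
  -- `ψ(−1) = z ^ φ(q^b)`
  set z : R := ∏ s ∈ T₀, F s with hzdef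
  have hinj : ∀ x ∈ T₀ ×ˢ Uq, ∀ y ∈ T₀ ×ˢ Uq, e.symm x = e.symm y → x = y :=
    fun x _ y _ hxy => e.symm.injective hxy
  have hψP : z ^ (q ^ (b - 1) * (q - 1)) = -1 := by
    have h := congrArg ψ hP
    rw [map_prod, map_neg, map_one, Finset.prod_image hinj, Finset.prod_product] at h
    rw [← h, ← Nat.totient_prime_pow hq.out (Nat.pos_of_ne_zero hb), ← card_image_units (m' := q ^ b), ← hUq,
      hzdef, ← Finset.prod_pow]
    refine Finset.prod_congr rfl fun s hs => ?_
    rw [← Finset.prod_const]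
    refine Finset.prod_congr rfl fun a ha => ?_
    obtain ⟨a, -, rfl⟩ := Finset.mem_image.mp ha
    have hsu := (coprime_iff_isUnit s).mp (hT₀.1 s hs)
    exact hG _ _ (hℓu s hsu) (isUnit_chineseRemainder_symm hcop' hsu a.isUnit)
      (by rw [hℓ, val_chineseRemainder_symm_cast])
  -- `z ^ q = z`
  have hzq : z ^ q = z := by
    have hinj' : ∀ x ∈ T₀, ∀ y ∈ T₀, (q : ZMod n₀) * x = (q : ZMod n₀) * y → x = y :=
      fun x _ y _ hxy => hqu.mul_left_cancel hxy
    calc z ^ q = ∏ s ∈ T₀, F s ^ q := (Finset.prod_pow T₀ q F).symm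
      _ = ∏ s ∈ T₀, F ((q : ZMod n₀) * s) := Finset.prod_congr rfl hFq
      _ = ∏ s ∈ T₀.image ((q : ZMod n₀) * ·), F s := (Finset.prod_image hinj').symm
      _ = z := prod_eq_prod_of_isCMTypeSet (isCMTypeSet_image_mul hT₀ hqu) hT₀ F hFeven
  -- the idempotent `w = z^(q-1)`
  have hq2 : 2 ≤ q := hq.out.two_le
  set w : R := z ^ (q - 1) with hwdef
  have hw : IsIdempotentElem w := by
    change w * w = w
    rw [hwdef, ← pow_add, show q - 1 + (q - 1) = (q - 2) + q by omega, pow_add, hzq, ← pow_succ]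
    congr 1
    omega
  have hw1 : w = -1 := by
    rw [← hψP, mul_comm, pow_mul, ← hwdef]
    obtain ⟨k, hk⟩ := Nat.exists_eq_succ_of_ne_zero (pow_ne_zero (b - 1) hq.out.ne_zero)
    rw [hk]
    exact (hw.pow_succ_eq k).symm
  have hww : w * w = 1 := by rw [hw1]; ring
  rw [hw.eq, hw1] at hww
  exact h2 (by linear_combination -hww)

end Engine

end Summit.HodgeConjecture.Ring2WeilCoverage.RealUnitNormFrobenius

end
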